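import Summits.QuantumFields.BalabanUV.Beta.EriceFlowEnclosureB12AsPrintedHistoryContagionShiftFlowRepin
import Summits.QuantumFields.BalabanUV.Beta.EriceFlowEnclosureB12AsPrintedHistoryContagionShiftFlowPicardLimit

/-!
# Beta / EriceFlowEnclosureB12AsPrintedHistoryContagionShiftFlowRepinPicard — ASYMPTOTIC FREEDOM IS CONTAGIOUS, part 24: THE REFERENCE IS PICARD-COMPUTABLE FROM ITS OWN
# PIN.  Parts 12 ∕ 13 ∕ 19 ran node U2's lattice-free scheme `(picard B e)^[n] u → solution` with the pin e serving ALSO as the half-width of the envelope 2e (base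
# property `1∕(4e²) + (β*∕4)m ≤ 1∕e² + drive B u m`), which is why existence of node U2's `solution B e` as a box solution needed `e²∕g*² ≲ ¾` — a pin strictly below the
# reference's.  §33 re-runs part 19's §21 with the pin p DECOUPLED from the half-width e: base property `1∕(4e²) + (β*∕4)m ≤ 1∕p² + drive B u m` for box u ≤ 2e ⟹
# `(picard B p)^[n] u` converges scale by scale to a box solution of `MemFlow B p ·` with the profile `1∕(4e²) + (β*∕4)m`, at rate 2^{−n} (constants LITERALLY those of
# parts 12–13: κ = 8C_m e³∕((1 − θ∕θ₁)(1 − θ₁)) ≤ ½ under `64C_m e³ ≤ (1 − θ)²`; part 19's §21 is p = e).  §34 — AT THE REFERENCE PIN: part 23's free-envelope base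
# property (e = g*, a = t_a) feeds §33 with p = g* ⟹ **node U2's `solution B g*` is a box solution from g*, the scale-wise limit of node U2's `iterate B g*`, and by
# part 23's `memFlow_unique_at_reference` it IS the reference t**: every asymptotically free box solution with a small reference scale (`2t_a ≤ γ`, `4C_m t_a ≤ β*(1 − θ)`,
# `t_a²K ≤ ½`, `64C_m t_a³ ≤ (1 − θ)²`) is COMPUTED by Picard iteration from the constant history at its own pin, `|iterate B g* (n+1) m − t(m)| ≤
# (32C_mγt_a³∕(1 − θ)²)(2∕(1+θ))^m 2^{−n}` — node U2's `gstar_eq_solution ∕ tendsto_iterate ∕ abs_iterate_sub_solution_le` for the reference itself, floor-free.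
# Abstract in B (β-flow team, prover 1, unit `b2b-balaban-beta-bflow-p1`, gen 38; ROW AP-I·Uc × NODE U2)

HONEST FRAMING (page 1 of everything the β sub-cell writes): discharging `BetaPertH` makes Bałaban's UV stability UNCONDITIONAL — a
real constructive-QFT result; it is NOT the continuum limit and NOT the Clay problem.  HONEST DEPENDENCY (cell reorg 2026-08-19,
verbatim): «continuum YM on T⁴ ⇐ BetaPertH ∧ nine spine estimates (0/9 proved); BetaPertH ⇐ (D1) ∧ (D4) ∧ CAP+tail; G-an2-4 gates
asym, D1 and NE2/3/4.»  THIS MODULE DISCHARGES NOTHING: [folklore] real analysis (part 19's §21 with one more free parameter — the third and, the pin being free, the last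
copy of that iteration) over node U2's HYPOTHESIS SHAPES `T4BetaStationary.{SeqBox, MemoryProfile}`, `T4BetaFlowWellPosed.{MemFlow, drive, picard, iterate, solution, bbar}`
on an ABSTRACT functional `B : (ℕ → ℝ) → ℝ` — node U2's hypothesis shapes, which node U2 derives for Bałaban's limit functional from NE4 ∕ moduli LETTERS (NOT PRINTED for
[I] = T. Bałaban, Commun. Math. Phys. **109** (1987) [Balaban1987RG1]: GAPS G-t4-U2-1 ∕ -2; the reference profile is the shape of (0.31)'s lower half, Theorem 2 p. 259,
STATED WITHOUT PROOF, in the continuum).  Nothing of Bałaban's β is asserted; node U2's `picard ∕ iterate ∕ solution ∕ drive_le_mul_bbar ∕ abs_drive_sub_drive_le ∕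
memFlow_of_invSq_eq ∕ one_div_sqrt_le` and parts 12–13's `invSq_picard ∕ picard_pos_of_base_pos ∕ abs_drive_sub_drive_le_weighted ∕ kappa_le_half ∕ mul_le_inv_pow ∕
tendsto_drive_of_tendsto ∕ iterate_eq_picardIter` are USED BY NAME; nothing of node U2's modules or of parts 1–23 is restated or modified.

WHAT THIS FILE PROVES (0 sorry, 0 def): §33 `picard_mem_of_basePin`, `picardIter_mem_of_basePin`, `picardIter_profile_of_basePin`, `invSq_picardIter_succ_of_basePin`,
`abs_invSq_picardIter_succ_sub_le_of_basePin`, `dist_picardIter_succ_le_of_basePin`, **`exists_memFlow_of_basePin`** (with the rate 2^{−n}); §34 **`base_at_reference`**,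
**`memFlow_solution_at_reference`**, **`solution_eq_at_reference`**, **`tendsto_iterate_at_reference`**, **`abs_iterate_sub_reference_le`**, `tendsto_picardIter_at_reference`.
NOT CLAIMED: anything about Bałaban's β; the cocycle (part 25); the carrier reading (part 26); `BetaPertH`; the continuum limit of the measures; Clay.
-/

namespace Summit.QuantumFields.BalabanUV.Beta.EriceFlowEnclosureB12AsPrintedHistoryContagionShiftFlowRepinPicard

open Finset Filter Topology
open Literature.MathematicalPhysics.QuantumFieldTheory.Balaban1983to89
open Literature.MathematicalPhysics.QuantumFieldTheory.Balaban1983to89.T4CouplingMatching (prof sprof sprof_pos sprof_sq prof_pos abs_sub_le_of_inv_sq)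
open Literature.MathematicalPhysics.QuantumFieldTheory.Balaban1983to89.T4BetaStationary (SeqBox MemoryProfile summable_profile abs_sub_le_of_seqBox
  tsum_profile_le)
open Literature.MathematicalPhysics.QuantumFieldTheory.Balaban1983to89.T4BetaFlowWellPosed (MemFlow drive drive_succ drive_zero picard iterate solution
  iterate_zero iterate_succ seqBox_shift invSq_eq_of_memFlow memFlow_of_invSq_eq abs_drive_sub_drive_le bbar drive_le_mul_bbar)
open Summit.QuantumFields.BalabanUV.Beta.EriceFlowEnclosureB12AsPrintedHistoryContagionProfile (le_two_mul_of_profile)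
open Summit.QuantumFields.BalabanUV.Beta.EriceFlowEnclosureB12AsPrintedHistoryContagionShiftFlow (le_invSprof_of_prof_le)
open Summit.QuantumFields.BalabanUV.Beta.EriceFlowEnclosureB12AsPrintedHistoryContagionShiftFlowPicard (invSq_picard picard_pos_of_base_pos
  abs_drive_sub_drive_le_weighted mul_le_inv_pow kappa_le_half)
open Summit.QuantumFields.BalabanUV.Beta.EriceFlowEnclosureB12AsPrintedHistoryContagionShiftFlowPicardLimit (tendsto_drive_of_tendsto prof_le_invSq_of_le_invSprof
  iterate_eq_picardIter)
open Summit.QuantumFields.BalabanUV.Beta.EriceFlowEnclosureB12AsPrintedHistoryContagionShiftFlowRepin (base_lower_of_envelope_pin le_of_profile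
  memFlow_unique_at_reference)

noncomputable section

/-! ## §33 The Picard scheme with the pin decoupled from the envelope -/

/-- THE SOLUTION MAP UNDER THE BASE PROPERTY WITH A FREE PIN: if `1∕(4e²) + (β*∕4)m ≤ 1∕p² + drive B u m` for every box history u ≤ 2e (β* ≥ 0, 0 < e, 2e ≤ γ), then
`picard B p` maps the class «box, ≤ 2e» into itself WITH the profile `1∕(4e²) + (β*∕4)m` (part 19's `picard_mem_of_base` is p = e). [folklore] -/
theorem picard_mem_of_basePin {B : (ℕ → ℝ) → ℝ} {γ bs e p : ℝ} {u : ℕ → ℝ} (hbs : 0 ≤ bs) (he : 0 < e) (h2e : 2 * e ≤ γ)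
    (hbase : ∀ v : ℕ → ℝ, SeqBox γ v → (∀ q, v q ≤ 2 * e) → ∀ m : ℕ, 1 / (4 * e ^ 2) + bs / 4 * (m : ℝ) ≤ 1 / p ^ 2 + drive B v m)
    (hus : SeqBox γ u) (henv : ∀ q, u q ≤ 2 * e) :
    SeqBox γ (picard B p u) ∧ (∀ m : ℕ, 1 / (4 * e ^ 2) + bs / 4 * (m : ℝ) ≤ 1 / (picard B p u m) ^ 2) ∧ ∀ q, picard B p u q ≤ 2 * e := by
  have hb := hbase u hus henv
  have hS : ∀ m : ℕ, 0 < 1 / p ^ 2 + drive B u m := fun m =>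
    (by positivity : (0 : ℝ) < 1 / (4 * e ^ 2) + bs / 4 * (m : ℝ)).trans_le (hb m)
  have hprof' : ∀ m : ℕ, 1 / (4 * e ^ 2) + bs / 4 * (m : ℝ) ≤ 1 / (picard B p u m) ^ 2 := fun m => by
    rw [invSq_picard (hS m)]; exact hb m
  have hpos : ∀ m, 0 < picard B p u m := fun m => picard_pos_of_base_pos (hS m)
  have hle : ∀ q, picard B p u q ≤ 2 * e := fun q => le_two_mul_of_profile hbs he (hpos q) (Nat.cast_nonneg q) (hprof' q)
  exact ⟨fun q => ⟨hpos q, (hle q).trans h2e⟩, hprof', hle⟩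

/-- Every iterate from an enveloped start is box-valued and ≤ 2e (base property with a free pin). [folklore] -/
theorem picardIter_mem_of_basePin {B : (ℕ → ℝ) → ℝ} {γ bs e p : ℝ} {u : ℕ → ℝ} (hbs : 0 ≤ bs) (he : 0 < e) (h2e : 2 * e ≤ γ)
    (hbase : ∀ v : ℕ → ℝ, SeqBox γ v → (∀ q, v q ≤ 2 * e) → ∀ m : ℕ, 1 / (4 * e ^ 2) + bs / 4 * (m : ℝ) ≤ 1 / p ^ 2 + drive B v m)
    (hus : SeqBox γ u) (henv : ∀ q, u q ≤ 2 * e) :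
    ∀ n : ℕ, SeqBox γ ((picard B p)^[n] u) ∧ ∀ q, (picard B p)^[n] u q ≤ 2 * e := by
  intro n
  induction n with
  | zero => exact ⟨hus, henv⟩
  | succ n ih =>
    rw [Function.iterate_succ_apply']
    have h := picard_mem_of_basePin hbs he h2e hbase ih.1 ih.2
    exact ⟨h.1, h.2.2⟩

/-- From the first step on the iterates carry the profile `1∕(4e²) + (β*∕4)m` (base property with a free pin). [folklore] -/
theorem picardIter_profile_of_basePin {B : (ℕ → ℝ) → ℝ} {γ bs e p : ℝ} {u : ℕ → ℝ} (hbs : 0 ≤ bs) (he : 0 < e) (h2e : 2 * e ≤ γ)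
    (hbase : ∀ v : ℕ → ℝ, SeqBox γ v → (∀ q, v q ≤ 2 * e) → ∀ m : ℕ, 1 / (4 * e ^ 2) + bs / 4 * (m : ℝ) ≤ 1 / p ^ 2 + drive B v m)
    (hus : SeqBox γ u) (henv : ∀ q, u q ≤ 2 * e) (n m : ℕ) :
    1 / (4 * e ^ 2) + bs / 4 * (m : ℝ) ≤ 1 / ((picard B p)^[n + 1] u m) ^ 2 := by
  rw [Function.iterate_succ_apply']
  have ih := picardIter_mem_of_basePin hbs he h2e hbase hus henv n
  exact (picard_mem_of_basePin hbs he h2e hbase ih.1 ih.2).2.1 m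

/-- The chart identity along the iteration: `1∕((picard B p)^[n+1] u)(m)² = 1∕p² + drive B ((picard B p)^[n] u) m` (base property with a free pin). [folklore] -/
theorem invSq_picardIter_succ_of_basePin {B : (ℕ → ℝ) → ℝ} {γ bs e p : ℝ} {u : ℕ → ℝ} (hbs : 0 ≤ bs) (he : 0 < e) (h2e : 2 * e ≤ γ)
    (hbase : ∀ v : ℕ → ℝ, SeqBox γ v → (∀ q, v q ≤ 2 * e) → ∀ m : ℕ, 1 / (4 * e ^ 2) + bs / 4 * (m : ℝ) ≤ 1 / p ^ 2 + drive B v m)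
    (hus : SeqBox γ u) (henv : ∀ q, u q ≤ 2 * e) (n m : ℕ) :
    1 / ((picard B p)^[n + 1] u m) ^ 2 = 1 / p ^ 2 + drive B ((picard B p)^[n] u) m := by
  rw [Function.iterate_succ_apply']
  have ih := picardIter_mem_of_basePin hbs he h2e hbase hus henv n
  exact invSq_picard ((by positivity : (0 : ℝ) < 1 / (4 * e ^ 2) + bs / 4 * (m : ℝ)).trans_le (hbase _ ih.1 ih.2 m))

/-- Consecutive iterates contract in the θ₁-weighted chart: `|1∕((picard B p)^[n+2] u)(q)² − 1∕((picard B p)^[n+1] u)(q)²| ≤ κ^n·A₀∕θ₁^q`, `κ = 8C_m e³∕((1 − θ∕θ₁)(1 − θ₁))`,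
`A₀ = C_mγ∕((1 − θ)(1 − θ₁))` — the pin does not enter (base property with a free pin + memory profile; part 12's `abs_drive_sub_drive_le_weighted`). [folklore] -/
theorem abs_invSq_picardIter_succ_sub_le_of_basePin {B : (ℕ → ℝ) → ℝ} {Cm θ θ₁ γ bs e p : ℝ} {u : ℕ → ℝ}
    (hB : MemoryProfile Cm θ γ B) (hCm : 0 ≤ Cm) (hθ0 : 0 ≤ θ) (hθ1 : θ < 1) (hbs : 0 ≤ bs) (he : 0 < e) (h2e : 2 * e ≤ γ)
    (hbase : ∀ v : ℕ → ℝ, SeqBox γ v → (∀ q, v q ≤ 2 * e) → ∀ m : ℕ, 1 / (4 * e ^ 2) + bs / 4 * (m : ℝ) ≤ 1 / p ^ 2 + drive B v m)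
    (hus : SeqBox γ u) (henv : ∀ q, u q ≤ 2 * e) (hθθ₁ : θ < θ₁) (hθ₁1 : θ₁ < 1) :
    ∀ n q : ℕ, |1 / ((picard B p)^[n + 2] u q) ^ 2 - 1 / ((picard B p)^[n + 1] u q) ^ 2|
      ≤ (8 * Cm * e ^ 3 / ((1 - θ / θ₁) * (1 - θ₁))) ^ n * (Cm * (γ / (1 - θ)) / (1 - θ₁)) / θ₁ ^ q := by
  have hmem := picardIter_mem_of_basePin hbs he h2e hbase hus henv
  have hinv := invSq_picardIter_succ_of_basePin hbs he h2e hbase hus henv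
  have hθ₁0 : 0 < θ₁ := lt_of_le_of_lt hθ0 hθθ₁
  have h1θ₁ : 0 < 1 - θ₁ := by linarith
  have h1θ : 0 < 1 - θ := by linarith
  have hγ : 0 ≤ γ := (hus 0).1.le.trans (hus 0).2
  have hA₀0 : 0 ≤ Cm * (γ / (1 - θ)) / (1 - θ₁) := by positivity
  intro n
  induction n with
  | zero =>
    intro q
    rw [hinv 1 q, hinv 0 q, add_sub_add_left_eq_sub, pow_zero, one_mul]
    have h := abs_drive_sub_drive_le (B' := B) (η := 0) hB hCm hθ0 hθ1 (fun v _ => by simp) (hmem 1).1 (hmem 0).1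
      (D := γ) (fun i => abs_sub_le_of_seqBox (hmem 1).1 (hmem 0).1 i) q
    rw [add_zero] at h
    calc |drive B ((picard B p)^[1] u) q - drive B ((picard B p)^[0] u) q| ≤ (q : ℝ) * (Cm * (γ / (1 - θ))) := h
      _ = ((q : ℝ) * (1 - θ₁)) * (Cm * (γ / (1 - θ)) / (1 - θ₁)) := by field_simp
      _ ≤ (1 / θ₁ ^ q) * (Cm * (γ / (1 - θ)) / (1 - θ₁)) := mul_le_mul_of_nonneg_right (mul_le_inv_pow hθ₁0 hθ₁1 q) hA₀0
      _ = Cm * (γ / (1 - θ)) / (1 - θ₁) / θ₁ ^ q := by ring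
  | succ n ih =>
    intro q
    rw [show n + 1 + 2 = n + 2 + 1 from rfl, hinv (n + 2) q, hinv (n + 1) q, add_sub_add_left_eq_sub]
    have hp := abs_drive_sub_drive_le_weighted hB hCm hθ0 hθθ₁ hθ₁1 he.le (hmem (n + 2)).1 (hmem (n + 1)).1 (hmem (n + 2)).2
      (hmem (n + 1)).2 ih q
    calc |drive B ((picard B p)^[n + 2] u) q - drive B ((picard B p)^[n + 1] u) q|
        ≤ 8 * Cm * e ^ 3 / ((1 - θ / θ₁) * (1 - θ₁)) * ((8 * Cm * e ^ 3 / ((1 - θ / θ₁) * (1 - θ₁))) ^ n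
            * (Cm * (γ / (1 - θ)) / (1 - θ₁))) / θ₁ ^ q := hp
      _ = (8 * Cm * e ^ 3 / ((1 - θ / θ₁) * (1 - θ₁))) ^ (n + 1) * (Cm * (γ / (1 - θ)) / (1 - θ₁)) / θ₁ ^ q := by
          rw [pow_succ]; ring

/-- In the coupling chart consecutive iterates are `(8e³A₀∕θ₁^q)·κ^n`-close (base property with a free pin + memory profile). [folklore] -/
theorem dist_picardIter_succ_le_of_basePin {B : (ℕ → ℝ) → ℝ} {Cm θ θ₁ γ bs e p : ℝ} {u : ℕ → ℝ}
    (hB : MemoryProfile Cm θ γ B) (hCm : 0 ≤ Cm) (hθ0 : 0 ≤ θ) (hθ1 : θ < 1) (hbs : 0 ≤ bs) (he : 0 < e) (h2e : 2 * e ≤ γ)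
    (hbase : ∀ v : ℕ → ℝ, SeqBox γ v → (∀ q, v q ≤ 2 * e) → ∀ m : ℕ, 1 / (4 * e ^ 2) + bs / 4 * (m : ℝ) ≤ 1 / p ^ 2 + drive B v m)
    (hus : SeqBox γ u) (henv : ∀ q, u q ≤ 2 * e) (hθθ₁ : θ < θ₁) (hθ₁1 : θ₁ < 1) (q n : ℕ) :
    dist ((picard B p)^[n + 1] u q) ((picard B p)^[n + 1 + 1] u q)
      ≤ (8 * e ^ 3 * (Cm * (γ / (1 - θ)) / (1 - θ₁)) / θ₁ ^ q) * (8 * Cm * e ^ 3 / ((1 - θ / θ₁) * (1 - θ₁))) ^ n := by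
  have hmem := picardIter_mem_of_basePin hbs he h2e hbase hus henv
  have hdiff := abs_invSq_picardIter_succ_sub_le_of_basePin hB hCm hθ0 hθ1 hbs he h2e hbase hus henv hθθ₁ hθ₁1
  have hθ₁0 : 0 < θ₁ := lt_of_le_of_lt hθ0 hθθ₁
  have hr1 : θ / θ₁ < 1 := (div_lt_one hθ₁0).mpr hθθ₁
  have h1r : 0 < 1 - θ / θ₁ := by linarith
  have h1θ₁ : 0 < 1 - θ₁ := by linarith
  have h1θ : 0 < 1 - θ := by linarith
  have hγ : 0 ≤ γ := (hus 0).1.le.trans (hus 0).2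
  rw [Real.dist_eq]
  have ha := ((hmem (n + 1)).1 q).1
  have hb := ((hmem (n + 1 + 1)).1 q).1
  have hw : ((picard B p)^[n + 1] u q) ^ 2 * (picard B p)^[n + 1 + 1] u q ≤ 8 * e ^ 3 := by
    have h1 : ((picard B p)^[n + 1] u q) ^ 2 ≤ (2 * e) ^ 2 := pow_le_pow_left₀ ha.le ((hmem (n + 1)).2 q) 2
    calc ((picard B p)^[n + 1] u q) ^ 2 * (picard B p)^[n + 1 + 1] u q ≤ (2 * e) ^ 2 * (2 * e) :=
          mul_le_mul h1 ((hmem (n + 1 + 1)).2 q) hb.le (by positivity)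
      _ = 8 * e ^ 3 := by ring
  have hd : |1 / ((picard B p)^[n + 1] u q) ^ 2 - 1 / ((picard B p)^[n + 1 + 1] u q) ^ 2|
      ≤ (8 * Cm * e ^ 3 / ((1 - θ / θ₁) * (1 - θ₁))) ^ n * (Cm * (γ / (1 - θ)) / (1 - θ₁)) / θ₁ ^ q := by
    rw [abs_sub_comm]; exact hdiff n q
  calc |(picard B p)^[n + 1] u q - (picard B p)^[n + 1 + 1] u q|
      ≤ ((picard B p)^[n + 1] u q) ^ 2 * (picard B p)^[n + 1 + 1] u q
          * |1 / ((picard B p)^[n + 1] u q) ^ 2 - 1 / ((picard B p)^[n + 1 + 1] u q) ^ 2| := abs_sub_le_of_inv_sq ha hb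
    _ ≤ 8 * e ^ 3 * ((8 * Cm * e ^ 3 / ((1 - θ / θ₁) * (1 - θ₁))) ^ n * (Cm * (γ / (1 - θ)) / (1 - θ₁)) / θ₁ ^ q) :=
        mul_le_mul hw hd (abs_nonneg _) (by positivity)
    _ = (8 * e ^ 3 * (Cm * (γ / (1 - θ)) / (1 - θ₁)) / θ₁ ^ q) * (8 * Cm * e ^ 3 / ((1 - θ / θ₁) * (1 - θ₁))) ^ n := by ring

/-- **EXISTENCE FROM THE BASE PROPERTY WITH A FREE PIN, WITH THE RATE.**  `B` with memory profile `(C_m, θ)` on ]0, γ]^ℕ; a half-width `0 < e`, `2e ≤ γ`, `64C_m e³ ≤ (1 − θ)²`;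
a pin p > 0; the base property `1∕(4e²) + (β*∕4)m ≤ 1∕p² + drive B v m` for box v ≤ 2e (β* ≥ 0); ANY box start u ≤ 2e.  THEN the iterates `(picard B p)^[n] u` converge
scale by scale to a box solution h of `MemFlow B p h` with `1∕(4e²) + (β*∕4)m ≤ 1∕h(m)²`, and `|((picard B p)^[n+1] u)(q) − h(q)| ≤ (32C_mγe³∕(1 − θ)²)(2∕(1+θ))^q 2^{−n}`
(part 19's `exists_memFlow_of_base` with the pin freed; part 13's rate). [folklore] -/
theorem exists_memFlow_of_basePin {B : (ℕ → ℝ) → ℝ} {Cm θ γ bs e p : ℝ} {u : ℕ → ℝ}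
    (hB : MemoryProfile Cm θ γ B) (hCm : 0 ≤ Cm) (hθ0 : 0 ≤ θ) (hθ1 : θ < 1) (hbs : 0 ≤ bs) (he : 0 < e) (h2e : 2 * e ≤ γ) (hp : 0 < p)
    (hbase : ∀ v : ℕ → ℝ, SeqBox γ v → (∀ q, v q ≤ 2 * e) → ∀ m : ℕ, 1 / (4 * e ^ 2) + bs / 4 * (m : ℝ) ≤ 1 / p ^ 2 + drive B v m)
    (hus : SeqBox γ u) (henv : ∀ q, u q ≤ 2 * e) (hs4 : 64 * Cm * e ^ 3 ≤ (1 - θ) ^ 2) :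
    ∃ h : ℕ → ℝ, SeqBox γ h ∧ MemFlow B p h ∧ (∀ m : ℕ, 1 / (4 * e ^ 2) + bs / 4 * (m : ℝ) ≤ 1 / (h m) ^ 2) ∧
      (∀ q, Tendsto (fun n => (picard B p)^[n] u q) atTop (𝓝 (h q))) ∧
      ∀ q n : ℕ, |(picard B p)^[n + 1] u q - h q| ≤ 32 * Cm * γ * e ^ 3 / (1 - θ) ^ 2 / ((1 + θ) / 2) ^ q * (1 / 2) ^ n := by
  obtain ⟨hθθ₁, hθ₁1, hκ0, hκ1⟩ := kappa_le_half hCm hθ0 hθ1 he.le hs4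
  set θ₁ : ℝ := (1 + θ) / 2 with hθ₁def
  set κ : ℝ := 8 * Cm * e ^ 3 / ((1 - θ / θ₁) * (1 - θ₁)) with hκdef
  set A₀ : ℝ := Cm * (γ / (1 - θ)) / (1 - θ₁) with hA₀def
  have hκ1' : κ < 1 := by linarith
  have hγ0 : 0 < γ := by linarith
  have hθ₁0 : 0 < θ₁ := lt_of_le_of_lt hθ0 hθθ₁
  have h1θ : 0 < 1 - θ := by linarith
  have hmem := picardIter_mem_of_basePin hbs he h2e hbase hus henv
  have hprofit := picardIter_profile_of_basePin hbs he h2e hbase hus henv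
  have hinv := invSq_picardIter_succ_of_basePin hbs he h2e hbase hus henv
  have hstep : ∀ q n, dist ((picard B p)^[n + 1] u q) ((picard B p)^[n + 1 + 1] u q) ≤ (8 * e ^ 3 * A₀ / θ₁ ^ q) * κ ^ n :=
    fun q n => dist_picardIter_succ_le_of_basePin hB hCm hθ0 hθ1 hbs he h2e hbase hus henv hθθ₁ hθ₁1 q n
  have hcauchy : ∀ q, CauchySeq fun n => (picard B p)^[n + 1] u q := fun q =>
    cauchySeq_of_le_geometric κ (8 * e ^ 3 * A₀ / θ₁ ^ q) hκ1' (hstep q)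
  refine ⟨fun q => limUnder atTop fun n => (picard B p)^[n] u q, ?_⟩
  have hlim : ∀ q, Tendsto (fun n => (picard B p)^[n] u q) atTop (𝓝 (limUnder atTop fun n => (picard B p)^[n] u q)) := by
    intro q
    obtain ⟨L, hL⟩ := cauchySeq_tendsto_of_complete (hcauchy q)
    exact tendsto_nhds_limUnder ⟨L, (tendsto_add_atTop_iff_nat 1).mp hL⟩
  set h : ℕ → ℝ := fun q => limUnder atTop fun n => (picard B p)^[n] u q with hhdef
  have hlim1 : ∀ q, Tendsto (fun n => (picard B p)^[n + 1] u q) atTop (𝓝 (h q)) := fun q =>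
    (tendsto_add_atTop_iff_nat 1).mpr (hlim q)
  have hlow : ∀ (q n : ℕ), 1 / Real.sqrt (1 / p ^ 2 + (q : ℝ) * bbar B Cm θ γ) ≤ (picard B p)^[n + 1] u q := by
    intro q n
    have hM : 1 / ((picard B p)^[n + 1] u q) ^ 2 ≤ 1 / p ^ 2 + (q : ℝ) * bbar B Cm θ γ := by
      rw [hinv n q]; linarith [drive_le_mul_bbar hB hCm hθ0 hθ1 hγ0 (hmem n).1 q]
    exact T4BetaFlowWellPosed.one_div_sqrt_le ((hmem (n + 1)).1 q).1 hM
  have hposh : ∀ q, 0 < h q := by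
    intro q
    have hM0 : 0 < 1 / p ^ 2 + (q : ℝ) * bbar B Cm θ γ := by
      have hp1 := ((hmem (0 + 1)).1 q).1
      have hM : 1 / ((picard B p)^[0 + 1] u q) ^ 2 ≤ 1 / p ^ 2 + (q : ℝ) * bbar B Cm θ γ := by
        rw [hinv 0 q]; linarith [drive_le_mul_bbar hB hCm hθ0 hθ1 hγ0 (hmem 0).1 q]
      exact (one_div_pos.mpr (pow_pos hp1 2)).trans_le hM
    exact (one_div_pos.mpr (Real.sqrt_pos.mpr hM0)).trans_le (ge_of_tendsto' (hlim1 q) fun n => hlow q n)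
  have hhs : SeqBox γ h := fun q => ⟨hposh q, le_of_tendsto' (hlim q) fun n => ((hmem n).1 q).2⟩
  have h2e0 : 0 < 2 * e := by positivity
  have hb4 : 0 ≤ bs / 4 := by positivity
  have e4 : (2 * e) ^ 2 = 4 * e ^ 2 := by ring
  have hprofh : ∀ m : ℕ, 1 / (4 * e ^ 2) + bs / 4 * (m : ℝ) ≤ 1 / (h m) ^ 2 := by
    intro m
    have hle : ∀ n, (picard B p)^[n + 1] u m ≤ 1 / sprof (2 * e) (bs / 4) m := fun n =>
      le_invSprof_of_prof_le h2e0 hb4 ((hmem (n + 1)).1 m).1 (by rw [e4]; exact hprofit n m)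
    have := prof_le_invSq_of_le_invSprof h2e0 hb4 (hposh m) (le_of_tendsto' (hlim1 m) hle)
    rwa [e4] at this
  have hflow : ∀ m, 1 / (h m) ^ 2 = 1 / p ^ 2 + drive B h m := by
    intro m
    have h1 : Tendsto (fun n => 1 / ((picard B p)^[n + 1] u m) ^ 2) atTop (𝓝 (1 / p ^ 2 + drive B h m)) :=
      ((tendsto_drive_of_tendsto hB hθ0 hθ1 (fun n => (hmem n).1) hhs hlim m).const_add (1 / p ^ 2)).congr'
        (Eventually.of_forall fun n => (hinv n m).symm)
    have h2 : Tendsto (fun n => 1 / ((picard B p)^[n + 1] u m) ^ 2) atTop (𝓝 (1 / (h m) ^ 2)) :=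
      tendsto_const_nhds.div ((hlim1 m).pow 2) (pow_ne_zero 2 (hposh m).ne')
    exact tendsto_nhds_unique h2 h1
  have hrate : ∀ q n : ℕ, |(picard B p)^[n + 1] u q - h q| ≤ 32 * Cm * γ * e ^ 3 / (1 - θ) ^ 2 / θ₁ ^ q * (1 / 2) ^ n := by
    intro q n
    have hr := dist_le_of_le_geometric_of_tendsto κ _ hκ1' (hstep q) (hlim1 q) n
    rw [Real.dist_eq] at hr
    have hC : 8 * e ^ 3 * A₀ / θ₁ ^ q = 16 * Cm * γ * e ^ 3 / (1 - θ) ^ 2 / θ₁ ^ q := by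
      have h1θ₁ : 1 - θ₁ = (1 - θ) / 2 := by rw [hθ₁def]; ring
      have h1θne : (1 - θ) ≠ 0 := h1θ.ne'
      have hθ₁q : θ₁ ^ q ≠ 0 := pow_ne_zero q hθ₁0.ne'
      rw [hA₀def, h1θ₁]
      field_simp
      ring
    have hC0 : 0 ≤ 16 * Cm * γ * e ^ 3 / (1 - θ) ^ 2 / θ₁ ^ q := by positivity
    rw [hC] at hr
    calc |(picard B p)^[n + 1] u q - h q| ≤ 16 * Cm * γ * e ^ 3 / (1 - θ) ^ 2 / θ₁ ^ q * κ ^ n / (1 - κ) := hr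
      _ ≤ 16 * Cm * γ * e ^ 3 / (1 - θ) ^ 2 / θ₁ ^ q * (1 / 2) ^ n / (1 / 2) :=
          div_le_div₀ (by positivity) (mul_le_mul_of_nonneg_left (pow_le_pow_left₀ hκ0 hκ1 n) hC0) (by norm_num) (by linarith)
      _ = 32 * Cm * γ * e ^ 3 / (1 - θ) ^ 2 / θ₁ ^ q * (1 / 2) ^ n := by ring
  exact ⟨hhs, memFlow_of_invSq_eq hp hposh hflow, hprofh, hlim, hrate⟩

/-! ## §34 At the reference pin: node U2's `solution B g*` is the reference, computed from the constant history g* -/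

/-- **THE BASE PROPERTY AT THE REFERENCE PIN.**  `B` with memory profile `(C_m, θ)` on ]0, γ]^ℕ; ONE box solution t of `MemFlow B g* t` with `1∕t_a² + β*·m ≤ 1∕t(m)²`
(β* > 0, t_a > 0); `4C_m t_a ≤ β*(1 − θ)`, `t_a²·(C_mγ∕(1 − θ)² + (2C_m∕((1 − θ)β*))²) ≤ ½`.  THEN `1∕(4t_a²) + (β*∕4)m ≤ 1∕g*² + drive B v m` for every box history v ≤ 2t_a
and every scale m (part 23's `base_lower_of_envelope_pin` at e = g*, a = t_a). [cite: Balaban1987RG1, Thm 2 (0.31) p.259 with (0.20) p.256 and p.298] -/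
theorem base_at_reference {B : (ℕ → ℝ) → ℝ} {Cm θ γ bs ta gs : ℝ} {t : ℕ → ℝ}
    (hB : MemoryProfile Cm θ γ B) (hCm : 0 ≤ Cm) (hθ0 : 0 ≤ θ) (hθ1 : θ < 1) (hbs : 0 < bs) (hta : 0 < ta)
    (hts : SeqBox γ t) (htf : MemFlow B gs t) (hprof : ∀ m : ℕ, 1 / ta ^ 2 + bs * (m : ℝ) ≤ 1 / (t m) ^ 2)
    (hr1 : 4 * Cm * ta ≤ bs * (1 - θ))
    (hr2 : ta ^ 2 * (Cm * γ / (1 - θ) ^ 2 + (2 * Cm / ((1 - θ) * bs)) ^ 2) ≤ 1 / 2) :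
    ∀ v : ℕ → ℝ, SeqBox γ v → (∀ q, v q ≤ 2 * ta) → ∀ m : ℕ, 1 / (4 * ta ^ 2) + bs / 4 * (m : ℝ) ≤ 1 / gs ^ 2 + drive B v m := by
  intro v hvs henv m
  refine base_lower_of_envelope_pin hB hCm hθ0 hθ1 hbs hta hts htf hprof hta hvs henv hr1 ?_ m
  have hK : Cm * γ / (1 - θ) ^ 2 + (2 * Cm / ((1 - θ) * bs)) ^ 2 ≤ 1 / (2 * ta ^ 2) := by
    rw [le_div_iff₀ (by positivity)]; linarith
  have e1 : 1 / (4 * ta ^ 2) + 1 / (2 * ta ^ 2) = 3 / (4 * ta ^ 2) := by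
    field_simp; ring
  linarith

/-- **NODE U2's `solution B g*` IS A BOX SOLUTION AT THE REFERENCE PIN, FLOOR-FREE** — the scale-wise limit of node U2's `iterate B g*` (the constant start g* ≤ t_a is box-valued
and below 2t_a): `SeqBox γ (solution B g*)`, `MemFlow B g* (solution B g*)`, the profile `1∕(4t_a²) + (β*∕4)m`, `iterate B g* n m → solution B g* m`, and the rate
`|iterate B g* (n+1) m − solution B g* m| ≤ (32C_mγt_a³∕(1 − θ)²)(2∕(1+θ))^m 2^{−n}`, under `2t_a ≤ γ`, `4C_m t_a ≤ β*(1 − θ)`, `t_a²K ≤ ½`, `64C_m t_a³ ≤ (1 − θ)²` —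
part 13's `memFlow_solution_of_reference` AT the reference's pin instead of strictly below it. [cite: Balaban1987RG1, Thm 2 (0.31) p.259 with (0.20) p.256 and p.298] -/
theorem memFlow_solution_at_reference {B : (ℕ → ℝ) → ℝ} {Cm θ γ bs ta gs : ℝ} {t : ℕ → ℝ}
    (hB : MemoryProfile Cm θ γ B) (hCm : 0 ≤ Cm) (hθ0 : 0 ≤ θ) (hθ1 : θ < 1) (hbs : 0 < bs) (hta : 0 < ta)
    (hts : SeqBox γ t) (htf : MemFlow B gs t) (hprof : ∀ m : ℕ, 1 / ta ^ 2 + bs * (m : ℝ) ≤ 1 / (t m) ^ 2)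
    (h2ta : 2 * ta ≤ γ) (hr1 : 4 * Cm * ta ≤ bs * (1 - θ))
    (hr2 : ta ^ 2 * (Cm * γ / (1 - θ) ^ 2 + (2 * Cm / ((1 - θ) * bs)) ^ 2) ≤ 1 / 2)
    (hr4 : 64 * Cm * ta ^ 3 ≤ (1 - θ) ^ 2) :
    SeqBox γ (solution B gs) ∧ MemFlow B gs (solution B gs) ∧
      (∀ m : ℕ, 1 / (4 * ta ^ 2) + bs / 4 * (m : ℝ) ≤ 1 / (solution B gs m) ^ 2) ∧
      (∀ m, Tendsto (fun n => iterate B gs n m) atTop (𝓝 (solution B gs m))) ∧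
      ∀ m n : ℕ, |iterate B gs (n + 1) m - solution B gs m| ≤ 32 * Cm * γ * ta ^ 3 / (1 - θ) ^ 2 / ((1 + θ) / 2) ^ m * (1 / 2) ^ n := by
  have hgs : 0 < gs := by rw [← htf.1]; exact (hts 0).1
  have hgsta : gs ≤ ta := by rw [← htf.1]; exact le_of_profile hta hbs.le (hts 0).1 (hprof 0)
  have hus : SeqBox γ (fun _ : ℕ => gs) := fun _ => ⟨hgs, by linarith⟩
  have henv : ∀ q : ℕ, (fun _ : ℕ => gs) q ≤ 2 * ta := fun _ => by simp only; linarith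
  obtain ⟨h, hhs, hhf, hprofh, hlim, hrate⟩ := exists_memFlow_of_basePin hB hCm hθ0 hθ1 hbs.le hta h2ta hgs
    (base_at_reference hB hCm hθ0 hθ1 hbs hta hts htf hprof hr1 hr2) hus henv hr4
  have hlim' : ∀ m, Tendsto (fun n => iterate B gs n m) atTop (𝓝 (h m)) := fun m =>
    (hlim m).congr fun n => by rw [iterate_eq_picardIter]
  have hsol : solution B gs = h := funext fun m => (hlim' m).limUnder_eq
  rw [hsol]
  refine ⟨hhs, hhf, hprofh, hlim', fun m n => ?_⟩
  have hr := hrate m n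
  rwa [← iterate_eq_picardIter] at hr

/-- **NODE U2's `solution B g*` IS THE REFERENCE**: under the data of `memFlow_solution_at_reference`, `solution B g* = t` (part 23's `memFlow_unique_at_reference`;
`64C_m t_a³ ≤ (1 − θ)² < 4(1 − θ)²`). [cite: Balaban1987RG1, Thm 2 (0.31) p.259 with (0.20) p.256 and p.298] -/
theorem solution_eq_at_reference {B : (ℕ → ℝ) → ℝ} {Cm θ γ bs ta gs : ℝ} {t : ℕ → ℝ}
    (hB : MemoryProfile Cm θ γ B) (hCm : 0 ≤ Cm) (hθ0 : 0 ≤ θ) (hθ1 : θ < 1) (hbs : 0 < bs) (hta : 0 < ta)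
    (hts : SeqBox γ t) (htf : MemFlow B gs t) (hprof : ∀ m : ℕ, 1 / ta ^ 2 + bs * (m : ℝ) ≤ 1 / (t m) ^ 2)
    (h2ta : 2 * ta ≤ γ) (hr1 : 4 * Cm * ta ≤ bs * (1 - θ))
    (hr2 : ta ^ 2 * (Cm * γ / (1 - θ) ^ 2 + (2 * Cm / ((1 - θ) * bs)) ^ 2) ≤ 1 / 2)
    (hr4 : 64 * Cm * ta ^ 3 ≤ (1 - θ) ^ 2) : solution B gs = t := by
  have h1θ' : 0 < 1 - θ := by linarith
  have h1θ : 0 < (1 - θ) ^ 2 := by positivity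
  obtain ⟨hss, hsf, -, -, -⟩ := memFlow_solution_at_reference hB hCm hθ0 hθ1 hbs hta hts htf hprof h2ta hr1 hr2 hr4
  exact memFlow_unique_at_reference hB hCm hθ0 hθ1 hbs hta hts htf hprof hss hsf hr1 hr2 (by nlinarith)

/-- **THE REFERENCE IS PICARD-COMPUTABLE FROM ITS OWN PIN**: node U2's lattice-free iterates from the constant history g* converge to t at every scale,
`iterate B g* n m → t(m)`. [cite: Balaban1987RG1, Thm 2 (0.31) p.259 with (0.20) p.256 and p.298] -/
theorem tendsto_iterate_at_reference {B : (ℕ → ℝ) → ℝ} {Cm θ γ bs ta gs : ℝ} {t : ℕ → ℝ}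
    (hB : MemoryProfile Cm θ γ B) (hCm : 0 ≤ Cm) (hθ0 : 0 ≤ θ) (hθ1 : θ < 1) (hbs : 0 < bs) (hta : 0 < ta)
    (hts : SeqBox γ t) (htf : MemFlow B gs t) (hprof : ∀ m : ℕ, 1 / ta ^ 2 + bs * (m : ℝ) ≤ 1 / (t m) ^ 2)
    (h2ta : 2 * ta ≤ γ) (hr1 : 4 * Cm * ta ≤ bs * (1 - θ))
    (hr2 : ta ^ 2 * (Cm * γ / (1 - θ) ^ 2 + (2 * Cm / ((1 - θ) * bs)) ^ 2) ≤ 1 / 2)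
    (hr4 : 64 * Cm * ta ^ 3 ≤ (1 - θ) ^ 2) (m : ℕ) : Tendsto (fun n => iterate B gs n m) atTop (𝓝 (t m)) := by
  obtain ⟨-, -, -, hlim, -⟩ := memFlow_solution_at_reference hB hCm hθ0 hθ1 hbs hta hts htf hprof h2ta hr1 hr2 hr4
  rw [← solution_eq_at_reference hB hCm hθ0 hθ1 hbs hta hts htf hprof h2ta hr1 hr2 hr4]
  exact hlim m

/-- … AT THE GEOMETRIC RATE: `|iterate B g* (n+1) m − t(m)| ≤ (32C_mγt_a³∕(1 − θ)²)(2∕(1+θ))^m 2^{−n}` — node U2's `abs_iterate_sub_solution_le` for the reference itself,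
floor-free. [cite: Balaban1987RG1, Thm 2 (0.31) p.259 with (0.20) p.256 and p.298] -/
theorem abs_iterate_sub_reference_le {B : (ℕ → ℝ) → ℝ} {Cm θ γ bs ta gs : ℝ} {t : ℕ → ℝ}
    (hB : MemoryProfile Cm θ γ B) (hCm : 0 ≤ Cm) (hθ0 : 0 ≤ θ) (hθ1 : θ < 1) (hbs : 0 < bs) (hta : 0 < ta)
    (hts : SeqBox γ t) (htf : MemFlow B gs t) (hprof : ∀ m : ℕ, 1 / ta ^ 2 + bs * (m : ℝ) ≤ 1 / (t m) ^ 2)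
    (h2ta : 2 * ta ≤ γ) (hr1 : 4 * Cm * ta ≤ bs * (1 - θ))
    (hr2 : ta ^ 2 * (Cm * γ / (1 - θ) ^ 2 + (2 * Cm / ((1 - θ) * bs)) ^ 2) ≤ 1 / 2)
    (hr4 : 64 * Cm * ta ^ 3 ≤ (1 - θ) ^ 2) (m n : ℕ) :
    |iterate B gs (n + 1) m - t m| ≤ 32 * Cm * γ * ta ^ 3 / (1 - θ) ^ 2 / ((1 + θ) / 2) ^ m * (1 / 2) ^ n := by
  obtain ⟨-, -, -, -, hrate⟩ := memFlow_solution_at_reference hB hCm hθ0 hθ1 hbs hta hts htf hprof h2ta hr1 hr2 hr4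
  rw [← solution_eq_at_reference hB hCm hθ0 hθ1 hbs hta hts htf hprof h2ta hr1 hr2 hr4]
  exact hrate m n

/-- EVERY START BELOW 2t_a COMPUTES THE REFERENCE: for any box-valued u ≤ 2t_a, `(picard B g*)^[n] u (q) → t(q)` at every scale q. [folklore] -/
theorem tendsto_picardIter_at_reference {B : (ℕ → ℝ) → ℝ} {Cm θ γ bs ta gs : ℝ} {t u : ℕ → ℝ}
    (hB : MemoryProfile Cm θ γ B) (hCm : 0 ≤ Cm) (hθ0 : 0 ≤ θ) (hθ1 : θ < 1) (hbs : 0 < bs) (hta : 0 < ta)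
    (hts : SeqBox γ t) (htf : MemFlow B gs t) (hprof : ∀ m : ℕ, 1 / ta ^ 2 + bs * (m : ℝ) ≤ 1 / (t m) ^ 2)
    (h2ta : 2 * ta ≤ γ) (hr1 : 4 * Cm * ta ≤ bs * (1 - θ))
    (hr2 : ta ^ 2 * (Cm * γ / (1 - θ) ^ 2 + (2 * Cm / ((1 - θ) * bs)) ^ 2) ≤ 1 / 2)
    (hr4 : 64 * Cm * ta ^ 3 ≤ (1 - θ) ^ 2) (hus : SeqBox γ u) (henv : ∀ q, u q ≤ 2 * ta) (q : ℕ) :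
    Tendsto (fun n => (picard B gs)^[n] u q) atTop (𝓝 (t q)) := by
  have hgs : 0 < gs := by rw [← htf.1]; exact (hts 0).1
  have h1θ' : 0 < 1 - θ := by linarith
  have h1θ : 0 < (1 - θ) ^ 2 := by positivity
  obtain ⟨h, hhs, hhf, -, hlim, -⟩ := exists_memFlow_of_basePin hB hCm hθ0 hθ1 hbs.le hta h2ta hgs
    (base_at_reference hB hCm hθ0 hθ1 hbs hta hts htf hprof hr1 hr2) hus henv hr4
  rw [← memFlow_unique_at_reference hB hCm hθ0 hθ1 hbs hta hts htf hprof hhs hhf hr1 hr2 (by nlinarith)]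
  exact hlim q

end

end Summit.QuantumFields.BalabanUV.Beta.EriceFlowEnclosureB12AsPrintedHistoryContagionShiftFlowRepinPicard
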